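import Literature.NumberTheory.EllipticCurves.IwasawaTwistModP
import Literature.NumberTheory.EllipticCurves.ZpExtensionUnramifiedProofs
import Literature.NumberTheory.GaloisRepresentations.GaloisRepUnramifiedProofs
import HarnessLib

/-!
# K6 crux `MuTransferX9` (stmt-BirchSwinnertonDyer-19276), CORE-PLAN S4.2 (file 2 of 3):
# (F5) as an OPERATOR identity on the coordinate module `Fin J → M`, the depth of an element in a
# `ℤ_p`-tower, and the local twist `𝒯_J|_{Γ_{K_q}}` at an `E`-split prime
# (MU-TRANSFER-PROOF (F5) and §2 Lemma 1 (ii): `𝒯_J^{φ̃=1} = T^{J−e}𝒯_J`, `(φ̃−1)𝒯_J = T^e𝒯_J`)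

Cell `bsd-smallim`, seat `bsd-smallim-koly` gen 7 (route `SmallImageMuTransfer`, rung K6, leaf
`Rank1Residual.BSDpOnClassX9`). HONEST FRAMING: TOOL theorems of local Galois cohomology and linear
algebra; no definition, no named fact, no `sorry`; nothing is asserted about any curve and nothing is
booked; class X9 stays TYPED at class level. The file serves the OPEN registered stub `stub_coreX9` of
crux 19276 (skeleton v4 0154dd5daf38efd6) — item "S4.2 Lemma 1 (local theory at E-split q, depth
e_q = e) [OPEN, M] … to be matched to twistModP" of k6-c2's CORE-PLAN (evidence #12) — and credits
nothing toward its closure (`--supports … --as helper`). PARTITION (D-0054): X9 (A4) × p ∈ {5, 7}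
(the statements are prime-generic, so also X10b ∧ ¬Surj at 3) — helper; closes NONE.

## Content (`𝒯_J = M ⊗ 𝔽_p[T]/(T^J)(χ_κ)` = k6-ty's `ZpExtension.twistModP` in the coordinate model
`Fin J → M`, shift `S` = `·T`, `unipotentPow a = (1+S)^a` = `·γ^a`; `p·M = 0` throughout)

* §0 **(F5) in operator form** (`unipotentPow_sub_one_eq_shiftEnd_pow_mul_unit`): for `p ∤ u`,
  `(1+S)^{p^m u} − 1 = S^{p^m}·V` with `V` a UNIT commuting with `S` (`(1+S)^{p^m} = 1 + S^{p^m}`, then a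
  binomial expansion in `ℤ[X]` evaluated at `S`; `V = u + S^{p^m} r(S)` = unit + nilpotent). Hence the FIXED
  POINTS of `(1+S)^{p^m u}` are `ker S^{p^m} = 𝒯_J[T^{p^m}] = T^{J−p^m}𝒯_J` (`unipotentPow_apply_eq_self_iff`,
  `shiftEnd_pow_apply_eq_zero_iff`), the IMAGE of `(1+S)^{p^m u} − 1` is `S^{p^m}𝒯_J = T^{p^m}𝒯_J`
  (`range_unipotentPow_sub_one_eq`, `mem_range_shiftEnd_pow_iff`), `#𝒯_J[T^e] = #M^e` (`natCard_shiftEnd_pow_ker`),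
  and `(ℓ − 1)𝒯_J = 0` when `p ∣ ℓ − 1`. (Power-series form of (F5) = `LevelE.one_add_X_pow_sub_one_eq_X_pow_mul_unit`,
  p419228; here the operator on the genuine coordinate module.)
* §2 **depth**: `twistExponent κ J g = p^m·u`, `p ∤ u`, for `g ∈ Gal(K̄/K_m) ∖ Gal(K̄/K_{m+1})`, `m + 1 ≤ J`
  ((F5): `v_p(b_q) = m_q − 1`, `e_q = p^{m_q−1}`), with the converse `mem_layerSubgroup_of_prime_pow_dvd_twistExponent`.
* §3 **the local twist at a finite place `q ∤ p`**: `κ` kills the local inertia (Washington 13.2 in the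
  tree's local form `apply_eq_one_of_mem_absInertia`), so `𝒯_J|_{Γ_{K_q}}` is UNRAMIFIED when `ρ` is
  (`toLocal_twistModP_apply_of_mem_absInertia`); an element `g ∈ Γ_{K_q}` with `ρ(res g) = 1` ("`q` is
  `E`-split": `φ̃ = 1 ⊗ g`) acts by `(1+S)^{κ(res g)}` alone (`toLocal_twistModP_apply_of_apply_eq_one`),
  and if `res g` has depth `m` its fixed points are `𝒯_J[T^{p^m}]` (`toLocal_twistModP_apply_eq_self_iff_of_split`)
  and `(g − 1)𝒯_J = T^{p^m}𝒯_J` (`range_toLocal_twistModP_sub_one_of_split`) — Lemma 1 (ii)'s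
  `𝒯_J^{φ̃=1} = T^e𝒯_J` and `H¹_ur = 𝒯_J/(φ̃−1) = 𝒯_J/T^e ≅ 𝒯_e` at `J = 2e`, `e = e_q`.

References: HOME/koly/MU-TRANSFER-PROOF.md §1 (F5), §2 Lemma 1; L. Washington, *Introduction to Cyclotomic
Fields* §13.1–13.2, Prop. 13.2 [Washington1997]; B. Mazur, K. Rubin, Mem. AMS 799 (2004) §5.3, Lemma 1.2.1
[MazurRubin2004].
-/

set_option linter.dupNamespace false
set_option autoImplicit false

noncomputable section

open scoped Classical

universe u

namespace Summit.BirchSwinnertonDyer.BirchSwinnertonDyer.Rank1Residual.LocalSplitPrime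

open Function Field ValuativeRel NumberField IsDedekindDomain
open Literature.NumberTheory.GaloisRepresentations
open Literature.NumberTheory.GaloisRepresentations.IsNonarchimedeanLocalField

/-! ## §0 (F5) in operator form on `Fin J → M`: `(1+S)^{p^m u} − 1 = S^{p^m}·(unit)` -/

section OperatorF5

open Literature.NumberTheory.EllipticCurves Polynomial

variable {M : Type*} [AddCommGroup M] {J : ℕ} {p : ℕ}

/-- `p = 0` in `End(Fin J → M)` when `p·M = 0`. [folklore] -/
theorem natCast_prime_end_eq_zero (hM : ∀ x : M, p • x = 0) :
    ((p : ℕ) : Module.End ℤ (Fin J → M)) = 0 := by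
  refine LinearMap.ext fun x => funext fun i => ?_
  rw [Module.End.natCast_apply, LinearMap.zero_apply, Pi.smul_apply, Pi.zero_apply, hM]

variable [Fact p.Prime]

/-- `(1+S)^{p^m} = 1 + S^{p^m}` on `Fin J → M` when `p·M = 0` ((F5): `(1+T)^{p^m} = 1 + T^{p^m}` in
characteristic `p`). [cite: Washington1997, §13.2 (arithmetic in Λ/(p, T^n))] -/
theorem unipotentPow_prime_pow_eq_one_add (hM : ∀ x : M, p • x = 0) (m : ℕ) :
    unipotentPow M J (p ^ m) = 1 + shiftEnd M J ^ (p ^ m) := by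
  rw [unipotentPow, one_add_pow_prime_pow_of_natCast_eq_zero (Fact.out : p.Prime)
    (natCast_prime_end_eq_zero hM)]

omit [Fact p.Prime] in
/-- Binomial expansion to second order in `ℤ[X]`: `(1 + X^n)^u = 1 + u·X^n + (X^n)²·r`. [folklore] -/
theorem one_add_X_pow_pow_eq (n u : ℕ) :
    ∃ r : ℤ[X], (1 + X ^ n) ^ u = 1 + (u : ℤ[X]) * X ^ n + (X ^ n) ^ 2 * r := by
  induction u with
  | zero => exact ⟨0, by simp⟩
  | succ k ih =>
    obtain ⟨r, hr⟩ := ih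
    refine ⟨r + (k : ℤ[X]) + X ^ n * r, ?_⟩
    rw [pow_succ, hr]
    push_cast
    ring

omit [Fact p.Prime] in
/-- An element commutes with every polynomial in itself. [folklore] -/
theorem commute_aeval_self {R A : Type*} [CommSemiring R] [Semiring A] [Algebra R A] (x : A)
    (f : R[X]) : Commute x (aeval x f) := by
  induction f using Polynomial.induction_on' with
  | add p q hp hq => rw [map_add]; exact hp.add_right hq
  | monomial n a =>
    rw [← C_mul_X_pow_eq_monomial, map_mul, map_pow, aeval_C, aeval_X]
    exact (Algebra.commute_algebraMap_left a x).symm.mul_right ((Commute.refl x).pow_right n)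

/-- A natural number prime to `p` acts invertibly on `Fin J → M` when `p·M = 0`. [folklore] -/
theorem isUnit_natCast_end_of_not_dvd (hM : ∀ x : M, p • x = 0) {u : ℕ} (hu : ¬ p ∣ u) :
    IsUnit ((u : ℕ) : Module.End ℤ (Fin J → M)) := by
  have hp : p.Prime := Fact.out
  have hcop : Nat.Coprime u p := Nat.coprime_comm.1 ((Nat.Prime.coprime_iff_not_dvd hp).2 hu)
  obtain ⟨v, hv⟩ := Int.mod_coprime hcop
  obtain ⟨c, hc⟩ := Int.modEq_iff_dvd.1 hv.symm
  -- `hc : (u : ℤ) * v - 1 = p * c`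
  have hone : ((u : ℕ) : Module.End ℤ (Fin J → M)) * ((v : ℤ) : Module.End ℤ (Fin J → M)) = 1 := by
    have hp0 := natCast_prime_end_eq_zero (J := J) hM
    have h2 : ((u : ℤ) * v : ℤ) = 1 + (p : ℤ) * c := by linarith
    have h3 : (((u : ℤ) * v : ℤ) : Module.End ℤ (Fin J → M)) = 1 := by
      rw [h2]; push_cast; rw [hp0, zero_mul, add_zero]
    rw [← h3]; push_cast; rfl
  have hone' : ((v : ℤ) : Module.End ℤ (Fin J → M)) * ((u : ℕ) : Module.End ℤ (Fin J → M)) = 1 := by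
    rw [← (Nat.cast_commute u _).eq]; exact hone
  exact isUnit_iff_exists.2 ⟨_, hone, hone'⟩

/-- **(F5) in operator form.** On `Fin J → M` with `p·M = 0`: for `p ∤ u`,
`(1+S)^{p^m·u} − 1 = S^{p^m} · V` with `V` a UNIT commuting with `S` (`V = u + S^{p^m}·r(S)`, `r` a
polynomial; MU-TRANSFER-PROOF (F5): `g − 1 = T^{e_q}·(unit)`, `e_q = p^{m_q − 1}`; the power-series form is
`LevelE.one_add_X_pow_sub_one_eq_X_pow_mul_unit`, p419228). [cite: Washington1997, §13.2 (arithmetic in Λ/(p, T^n))] -/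
theorem unipotentPow_sub_one_eq_shiftEnd_pow_mul_unit (hM : ∀ x : M, p • x = 0) (m u : ℕ)
    (hu : ¬ p ∣ u) :
    ∃ V : Module.End ℤ (Fin J → M), IsUnit V ∧ Commute (shiftEnd M J) V ∧
      unipotentPow M J (p ^ m * u) - 1 = shiftEnd M J ^ (p ^ m) * V := by
  set S : Module.End ℤ (Fin J → M) := shiftEnd M J with hS
  obtain ⟨r, hr⟩ := one_add_X_pow_pow_eq (p ^ m) u
  set Y : Module.End ℤ (Fin J → M) := S ^ (p ^ m) with hY
  set R : Module.End ℤ (Fin J → M) := aeval S r with hR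
  -- the expansion, evaluated at `S`
  have hexp : (1 + Y) ^ u = 1 + (u : Module.End ℤ (Fin J → M)) * Y + Y ^ 2 * R := by
    have h := congrArg (aeval S) hr
    simpa [map_pow, map_add, map_mul, map_natCast, aeval_X, aeval_one] using h
  have hSR : Commute S R := commute_aeval_self S r
  have hSY : Commute S Y := (Commute.refl S).pow_right _
  have hYR : Commute Y R := hSR.pow_left _
  refine ⟨(u : Module.End ℤ (Fin J → M)) + Y * R, ?_, ?_, ?_⟩
  · -- unit + (nilpotent commuting with it)
    have hnil : IsNilpotent (Y * R) := by
      refine hYR.isNilpotent_mul_right ⟨J, ?_⟩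
      rw [hY, ← pow_mul]
      exact shiftEnd_pow_eq_zero (Nat.le_mul_of_pos_left J (pow_pos (Fact.out : p.Prime).pos m))
    exact hnil.isUnit_add_left_of_commute (isUnit_natCast_end_of_not_dvd hM hu)
      (Nat.cast_commute u _).symm
  · exact (Nat.cast_commute u S).symm.add_right (hSY.mul_right hSR)
  · rw [unipotentPow, pow_mul, ← unipotentPow, unipotentPow_prime_pow_eq_one_add hM m, ← hS, ← hY,
      hexp, mul_add, ← (Nat.cast_commute u Y).eq, pow_two]
    noncomm_ring

/-- Consequence 1: **the fixed points of `(1+S)^{p^m u}` are `ker S^{p^m}`** — i.e.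
`𝒯_J^{φ̃ = 1} = 𝒯_J[T^{e}] = T^{J−e}𝒯_J` (MU-TRANSFER-PROOF Lemma 1 (ii): the values of transverse
classes). [cite: Washington1997, §13.2 (arithmetic in Λ/(p, T^n))] -/
theorem unipotentPow_apply_eq_self_iff (hM : ∀ x : M, p • x = 0) (m u : ℕ) (hu : ¬ p ∣ u)
    (x : Fin J → M) :
    unipotentPow M J (p ^ m * u) x = x ↔ (shiftEnd M J ^ (p ^ m)) x = 0 := by
  obtain ⟨V, hV, hcomm, hVeq⟩ := unipotentPow_sub_one_eq_shiftEnd_pow_mul_unit (J := J) hM m u hu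
  have h1 : unipotentPow M J (p ^ m * u) x = x ↔ (unipotentPow M J (p ^ m * u) - 1) x = 0 := by
    rw [LinearMap.sub_apply, Module.End.one_apply, sub_eq_zero]
  rw [h1, hVeq, (hcomm.pow_left (p ^ m)).eq, Module.End.mul_apply]
  obtain ⟨Vu, rfl⟩ := hV
  constructor
  · intro h
    have := congrArg (↑Vu⁻¹ : Module.End ℤ (Fin J → M)) h
    rwa [map_zero, ← Module.End.mul_apply, Units.inv_mul, Module.End.one_apply] at this
  · intro h
    rw [h, map_zero]

/-- Consequence 2: **the image of `(1+S)^{p^m u} − 1` is the image of `S^{p^m}`** — i.e.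
`(φ̃ − 1)𝒯_J = T^{e}𝒯_J` (MU-TRANSFER-PROOF Lemma 1 (ii): `H¹_ur = 𝒯_J/(φ̃−1) ≅ 𝒯_e`).
[cite: Washington1997, §13.2 (arithmetic in Λ/(p, T^n))] -/
theorem range_unipotentPow_sub_one_eq (hM : ∀ x : M, p • x = 0) (m u : ℕ) (hu : ¬ p ∣ u) :
    LinearMap.range (unipotentPow M J (p ^ m * u) - 1) = LinearMap.range (shiftEnd M J ^ (p ^ m)) := by
  obtain ⟨V, hV, -, hVeq⟩ := unipotentPow_sub_one_eq_shiftEnd_pow_mul_unit (J := J) hM m u hu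
  obtain ⟨Vu, rfl⟩ := hV
  have hsurj : Function.Surjective (↑Vu : Module.End ℤ (Fin J → M)) := fun x =>
    ⟨(↑Vu⁻¹ : Module.End ℤ (Fin J → M)) x, by
      rw [← Module.End.mul_apply, Units.mul_inv, Module.End.one_apply]⟩
  rw [hVeq, Module.End.mul_eq_comp, LinearMap.range_comp, LinearMap.range_eq_top.2 hsurj,
    Submodule.map_top]

/-- `ker S^e = T^{J−e}𝒯_J`: `S^e x = 0 ↔ x_j = 0` for `j + e < J`. [cite: Washington1997, §13.1–§13.2] -/
theorem shiftEnd_pow_apply_eq_zero_iff (e : ℕ) (x : Fin J → M) :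
    (shiftEnd M J ^ e) x = 0 ↔ ∀ j : Fin J, (j : ℕ) + e < J → x j = 0 := by
  constructor
  · intro h j hj
    have hi := congrFun h ⟨(j : ℕ) + e, hj⟩
    rw [shiftEnd_pow_apply, Pi.zero_apply, dif_neg (by simp)] at hi
    simpa using hi
  · intro h
    funext i
    rw [shiftEnd_pow_apply, Pi.zero_apply]
    by_cases hi : (i : ℕ) < e
    · rw [dif_pos hi]
    · rw [dif_neg hi]
      exact h _ (by simp; omega)

/-- `range S^e = T^{e}𝒯_J`: `x ∈ S^e(𝒯_J) ↔ x_i = 0` for `i < e`. [cite: Washington1997, §13.1–§13.2] -/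
theorem mem_range_shiftEnd_pow_iff (e : ℕ) (x : Fin J → M) :
    x ∈ LinearMap.range (shiftEnd M J ^ e) ↔ ∀ i : Fin J, (i : ℕ) < e → x i = 0 := by
  constructor
  · rintro ⟨y, rfl⟩ i hi
    rw [shiftEnd_pow_apply, dif_pos hi]
  · intro h
    refine ⟨fun j => if hj : (j : ℕ) + e < J then x ⟨(j : ℕ) + e, hj⟩ else 0, funext fun i => ?_⟩
    rw [shiftEnd_pow_apply]
    by_cases hi : (i : ℕ) < e
    · rw [dif_pos hi, h i hi]
    · rw [dif_neg hi, dif_pos (by simp; omega)]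
      congr 1
      ext; simp; omega

omit [Fact p.Prime] in
/-- `(ℓ − 1)·𝒯_J = 0` when `p ∣ ℓ − 1` (e.g. `q ≡ 1 (mod p)`, automatic at an `E`-split prime since
`det ρ̄(Fr_q) = q (mod p)`) and `p·M = 0`. [folklore] -/
theorem sub_one_smul_eq_zero_of_dvd (hM : ∀ x : M, p • x = 0) {ℓ : ℕ} (hpl : p ∣ ℓ - 1)
    (x : Fin J → M) : (ℓ - 1) • x = 0 := by
  obtain ⟨c, hc⟩ := hpl
  funext i
  rw [Pi.smul_apply, Pi.zero_apply, hc, mul_comm, mul_smul, hM, smul_zero]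

end OperatorF5

/-! ## §2 Depth of an element in a `ℤ_p`-extension: `twistExponent = p^m · (unit)` -/

section Depth

open Literature.NumberTheory.EllipticCurves

variable {K : Type u} [Field K] {p : ℕ} [Fact p.Prime] (κ : ZpExtension K p)

/-- `twistExponent` vanishes on `ker κ`. [cite: Washington1997, §13.1–§13.2] -/
theorem twistExponent_eq_zero_of_apply_eq_one (J : ℕ) {g : absoluteGaloisGroup K} (hg : κ g = 1) :
    κ.twistExponent J g = 0 := by
  rw [ZpExtension.twistExponent, hg, toAdd_one, map_zero, ZMod.val_zero]

/-- Converse of `prime_pow_dvd_twistExponent`: for `n ≤ J`, `p^n ∣ twistExponent κ J g ⟹ g ∈ Gal(K̄/K_n)`.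
[cite: Washington1997, §13.1–§13.2] -/
theorem mem_layerSubgroup_of_prime_pow_dvd_twistExponent {J n : ℕ} (hn : n ≤ J)
    {g : absoluteGaloisGroup K} (h : p ^ n ∣ κ.twistExponent J g) : g ∈ κ.layerSubgroup n := by
  rw [ZpExtension.mem_layerSubgroup, ← Ideal.mem_span_singleton, ← PadicInt.ker_toZModPow,
    RingHom.mem_ker, ← PadicInt.zmod_cast_comp_toZModPow _ _ hn, RingHom.comp_apply,
    ZMod.castHom_apply, ZMod.cast_eq_val]
  exact (ZMod.natCast_eq_zero_iff _ _).2 h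

/-- **Depth**: if `g ∈ Gal(K̄/K_m) ∖ Gal(K̄/K_{m+1})` and `m + 1 ≤ J`, then
`twistExponent κ J g = p^m · u` with `p ∤ u` (the element `g` — a Frobenius at an `E`-split prime `q`
with `q`'s depth `m_q − 1 = m` in the cyclotomic tower — acts on the twist by `(1+T)^{p^m u}`;
MU-TRANSFER-PROOF (F5) `v_p(b_q) = m_q − 1`). [cite: Washington1997, §13.1–§13.2] -/
theorem twistExponent_eq_prime_pow_mul_of_depth {J m : ℕ} (hm : m + 1 ≤ J)
    {g : absoluteGaloisGroup K} (hg : g ∈ κ.layerSubgroup m) (hg' : g ∉ κ.layerSubgroup (m + 1)) :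
    ∃ u : ℕ, ¬ p ∣ u ∧ κ.twistExponent J g = p ^ m * u := by
  obtain ⟨u, hu⟩ := κ.prime_pow_dvd_twistExponent (by omega : m ≤ J) hg
  refine ⟨u, fun hpu => hg' ?_, hu⟩
  refine mem_layerSubgroup_of_prime_pow_dvd_twistExponent κ hm ?_
  rw [hu, pow_succ]
  exact mul_dvd_mul_left _ hpu

end Depth

/-! ## §3 The local twist `𝒯_J|_{Γ_{K_q}}` at a finite place `q ∤ p`: unramified; at an `E`-split
Frobenius the action is unipotent of depth `e = p^m`, with fixed points `T^{J−e}𝒯_J` and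
`(φ̃ − 1)𝒯_J = T^e𝒯_J` -/

section SplitPrime

open Literature.NumberTheory.EllipticCurves

variable {K : Type u} [Field K] [NumberField K] {M : Type u} [AddCommGroup M] [TopologicalSpace M]
  [DiscreteTopology M] (ρ : DiscreteGaloisModule K M) {p : ℕ} [Fact p.Prime]
  (hM : ∀ x : M, p • x = 0) (κ : ZpExtension K p) (J : ℕ) (q : HeightOneSpectrum (𝓞 K))

/-- Unfolding: the local twist acts by `(1+S)^{κ(res g)} ∘ ρ(res g)`. [cite: Washington1997, §13.1–§13.2] -/
theorem toLocal_twistModP_apply (g : absoluteGaloisGroup (q.adicCompletion K)) (x : Fin J → M) :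
    GaloisRep.toLocal q (κ.twistModP ρ hM J) g x =
      unipotentPow M J (κ.twistExponent J (absGaloisRestrict K (q.adicCompletion K) g))
        (fun i => GaloisRep.toLocal q ρ g (x i)) := rfl

/-- **The twist character is unramified at `q ∤ p`**: `κ` kills the local inertia group at `q`
(Washington Prop. 13.2, in the tree's local form `apply_eq_one_of_mem_absInertia`). [cite: Washington1997, Prop. 13.2] -/
theorem apply_absGaloisRestrict_eq_one_of_mem_absInertia (hqp : (p : 𝓞 K) ∉ q.asIdeal)
    {t : absoluteGaloisGroup (q.adicCompletion K)} (ht : t ∈ absInertia (q.adicCompletion K)) :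
    κ (absGaloisRestrict K (q.adicCompletion K) t) = 1 :=
  apply_eq_one_of_mem_absInertia (q.ringChar_residueField_adicCompletion_ne hqp)
    (κ.toContinuousMonoidHom.comp (absGaloisRestrict K (q.adicCompletion K))) ht

/-- **`𝒯_J` is unramified at `q`** when `ρ` is unramified at `q` and `q ∤ p`: the local inertia
group acts trivially on the local twist. [cite: Washington1997, Prop. 13.2] -/
theorem toLocal_twistModP_apply_of_mem_absInertia (hunr : GaloisRep.IsUnramifiedAt q ρ)
    (hqp : (p : 𝓞 K) ∉ q.asIdeal) {t : absoluteGaloisGroup (q.adicCompletion K)}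
    (ht : t ∈ absInertia (q.adicCompletion K)) (x : Fin J → M) :
    GaloisRep.toLocal q (κ.twistModP ρ hM J) t x = x := by
  rw [toLocal_twistModP_apply, twistExponent_eq_zero_of_apply_eq_one κ J
    (apply_absGaloisRestrict_eq_one_of_mem_absInertia κ q hqp ht), unipotentPow_zero,
    Module.End.one_apply]
  funext i
  rw [(GaloisRep.isUnramifiedAt_iff_toLocal_holds q ρ).1 hunr t ht, Module.End.one_apply]

/-- **At an `E`-split element** (`ρ(res g) = 1`) the local twist acts by the unipotent operator
`(1+S)^{κ(res g)}` alone (MU-TRANSFER-PROOF (F5): `φ̃ := ρ_𝒯(Fr_q) = 1 ⊗ g` is the "scalar" `g`).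
[cite: Washington1997, §13.1–§13.2] -/
theorem toLocal_twistModP_apply_of_apply_eq_one {g : absoluteGaloisGroup (q.adicCompletion K)}
    (hg : ρ (absGaloisRestrict K (q.adicCompletion K) g) = 1) (x : Fin J → M) :
    GaloisRep.toLocal q (κ.twistModP ρ hM J) g x =
      unipotentPow M J (κ.twistExponent J (absGaloisRestrict K (q.adicCompletion K) g)) x := by
  rw [toLocal_twistModP_apply]
  congr 1
  funext i
  rw [GaloisRep.toLocal_apply, hg, Module.End.one_apply]

/-- **Fixed points of an `E`-split element of depth `m` are `𝒯_J[T^{p^m}] = T^{J−p^m}𝒯_J`**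
(MU-TRANSFER-PROOF Lemma 1 (ii): `𝒯_J^{φ̃=1} = T^e𝒯_J` for `J = 2e`, `e = e_q = p^{m_q−1}`).
[cite: Washington1997, §13.1–§13.2] -/
theorem toLocal_twistModP_apply_eq_self_iff_of_split {g : absoluteGaloisGroup (q.adicCompletion K)}
    (hg : ρ (absGaloisRestrict K (q.adicCompletion K) g) = 1) {m : ℕ} (hm : m + 1 ≤ J)
    (hgm : absGaloisRestrict K (q.adicCompletion K) g ∈ κ.layerSubgroup m)
    (hgm' : absGaloisRestrict K (q.adicCompletion K) g ∉ κ.layerSubgroup (m + 1)) (x : Fin J → M) :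
    GaloisRep.toLocal q (κ.twistModP ρ hM J) g x = x ↔ (shiftEnd M J ^ (p ^ m)) x = 0 := by
  obtain ⟨u, hu, hb⟩ := twistExponent_eq_prime_pow_mul_of_depth κ hm hgm hgm'
  rw [toLocal_twistModP_apply_of_apply_eq_one ρ hM κ J q hg, hb]
  exact unipotentPow_apply_eq_self_iff hM m u hu x

/-- **The image of `φ̃ − 1` for an `E`-split element of depth `m` is `T^{p^m}𝒯_J`**
(MU-TRANSFER-PROOF Lemma 1 (ii): `H¹_ur = 𝒯_J/(φ̃−1)𝒯_J = 𝒯_J/T^e𝒯_J ≅ 𝒯_e`).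
[cite: Washington1997, §13.1–§13.2] -/
theorem range_toLocal_twistModP_sub_one_of_split {g : absoluteGaloisGroup (q.adicCompletion K)}
    (hg : ρ (absGaloisRestrict K (q.adicCompletion K) g) = 1) {m : ℕ} (hm : m + 1 ≤ J)
    (hgm : absGaloisRestrict K (q.adicCompletion K) g ∈ κ.layerSubgroup m)
    (hgm' : absGaloisRestrict K (q.adicCompletion K) g ∉ κ.layerSubgroup (m + 1)) :
    LinearMap.range ((GaloisRep.toLocal q (κ.twistModP ρ hM J) g : (Fin J → M) →ₗ[ℤ] (Fin J → M)) - 1) =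
      LinearMap.range (shiftEnd M J ^ (p ^ m)) := by
  obtain ⟨u, hu, hb⟩ := twistExponent_eq_prime_pow_mul_of_depth κ hm hgm hgm'
  have heq : ((GaloisRep.toLocal q (κ.twistModP ρ hM J) g : (Fin J → M) →ₗ[ℤ] (Fin J → M)) - 1) =
      unipotentPow M J (p ^ m * u) - 1 := by
    refine LinearMap.ext fun x => ?_
    rw [LinearMap.sub_apply, LinearMap.sub_apply, ← hb]
    exact congrArg (· - _) (toLocal_twistModP_apply_of_apply_eq_one ρ hM κ J q hg x)
  rw [heq]
  exact range_unipotentPow_sub_one_eq hM m u hu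

end SplitPrime

end Summit.BirchSwinnertonDyer.BirchSwinnertonDyer.Rank1Residual.LocalSplitPrime

end
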